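import Literature.MathematicalPhysics.QuantumFieldTheory.ConformalBootstrap3D.PointKernelK34L515.Cert

/-!
# K34L515 instance, cell `l6c2` (parts file: groups 0:32)

Kernel-v3 cell of the point-functional exclusion instance for the lower box `Δσ ∈ [0.515, 0.520]`,
`Δε ∈ [0.6, 0.95)` (certificate `certL515`, module `PointKernelK34L515.Cert`): spin `ℓ = 6`,
`Δ ∈ [29/4, 59/8)` (centre `A`, half-width `2^-4`), Taylor degree `4`, `n_F = 50`, `1` s-piece(s)
covering `s = Δσ ∈ [103/200, 13/25]`.  Group theorems `l6c2_part<i>_<a>_<b> : gPart … = some <literal>` are checked by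
`decide +kernel` (the literals were produced by `#eval` of the same function); the cell numbers `l6c2_num<i> ≥ 0`
likewise; `l6c2_block` is `PKTM.blockPositive_of_cellPass` applied to them. This file holds only group theorems (the cell stated as a literal); the final file of the cell imports it.  Generated by
`gen/mk_v3cell.py` / `gen/drive_v3.py` (typer-g8).  [folklore]
-/

set_option Elab.async false

namespace Literature.MathematicalPhysics.QuantumFieldTheory.ConformalBootstrap3D

namespace PointKernelK34L515

open PointKernel PKTM
open Literature.Analysis.ValidatedNumerics.PolyMP
open Literature.Analysis.ValidatedNumerics.NumericsMP

/-- group model literal [folklore] -/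
def l6c2_g0_32_34 : G3 := ([⟨547398169100555760459117089503565924449, 547398173412944840444891498215024948342⟩, ⟨58848154452855359801935399205479655462, 58848161382920660419315012098886069725⟩, ⟨-2405549540734386316993454304219267770, -2405539899100575388447880475944967079⟩, ⟨3579675732594257312142457586800278953, 3579686031842573473891501560807372405⟩, ⟨-2595076755259039350518132010971025323, -2595067506553892438143899065222867757⟩], [⟨-6599294225867908388280743484333262439, -6599294174026282038538361368613004563⟩, ⟨-703112639319390780160292502448445152, -703112555836946598346575463265377633⟩, ⟨25735250557567485504540608664167627, 25735366720861854754737773572978794⟩, ⟨-42082870361043415314197192252469769, -42082746256978166538786700819106668⟩, ⟨30997640381971379642548132193602240, 30997751843754612864478747110105106⟩], [⟨40234341498785729064547320708108206, 40234341814556984945412712996545989⟩, ⟨4276662748455335417401305887138605, 4276663257417128832824707880024972⟩, ⟨-149355073957553833297560109209409, -149354365635583841759936740660151⟩, ⟨254409524654166478225057241711755, 254410281533364963009288727601913⟩, ⟨-188379406993060838103598479088312, -188378727084277088793314669731907⟩])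

/-- group `[32, 34)` of piece 0 [folklore] -/
theorem l6c2_part0_32_34 : gPart certL515 (⟨6, ((117 : ℚ) / 16), 4, 4, 50, 6, 64, ⟨3, 0, 5, 84, 0, 0⟩⟩ : TMCell) (pc ps1 0) 32 34 = some l6c2_g0_32_34 := by decide +kernel

end PointKernelK34L515

end Literature.MathematicalPhysics.QuantumFieldTheory.ConformalBootstrap3D
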